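import Mathlib.NumberTheory.LocalField.Basic
import Mathlib.Data.Nat.PrimeFin
import Literature.NumberTheory.LocalFields.UnitsPrimePowerBijective
import Literature.NumberTheory.GaloisRepresentations.LocalExistenceLubinTate
import HarnessLib

/-!
# Ring isomorphisms of non-archimedean local fields respect the valuation rings

Classical local algebra (J.-P. Serre, *Local Fields*, GTM 67, Ch. II §3; J. Neukirch, *Algebraic Number Theory*,
Ch. II Prop. 5.7: for `(m, p) = 1` and `(m, q - 1) = 1` every unit is an `m`-th power) [cite: SerreLocalFields1979,
Ch. II §3] [cite: NeukirchANT1999, Ch. II Prop. 5.7]: in a non-archimedean local field `K` the valuation ring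
`𝒪_K` is determined by the FIELD structure alone —

* `infinite_setOf_exists_pow_eq_of_valuation_eq_one` — a UNIT `z ∈ 𝒪_K^×` has `n`-th roots in `K` for
  infinitely many `n` (every prime `ℓ > #𝓀`, the tree's `isUnit_exists_pow_eq_of_card_lt` — Hensel's lemma);
* `finite_setOf_exists_pow_eq_of_valuation_ne_one` — a NON-UNIT `z ≠ 0` has `n`-th roots for finitely many
  `n` only (`v(z) = v(ϖ)^k`, `k ≠ 0`, and `yⁿ = z` forces `n ∣ k`);
* `valuation_eq_one_iff_infinite` — hence `v(z) = 1 ↔ z ≠ 0 ∧ {n | ∃ y, yⁿ = z}` is infinite;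
* `mem_integer_iff_valuation_eq_one_or` — and `x ∈ 𝒪_K ↔ v(x) = 1 ∨ v(1 + x) = 1` (ultrametric);

so that EVERY ring isomorphism `φ : K₁ ≃+* K₂` of non-archimedean local fields satisfies
`v₁(z) = 1 ↔ v₂(φ z) = 1` (`RingEquiv.valuation_eq_one_iff_localField`) and
`x ∈ 𝒪_{K₁} ↔ φ x ∈ 𝒪_{K₂}` (`RingEquiv.mem_integer_iff_localField`) — i.e. `φ` is "valuative"
(equivalently continuous).  Written for the abc-iut cell (seat abc-iut-L1-d4): it DISCHARGES the standing binder
`hφ₀ : ∀ x, x ∈ 𝒪[K₁] ↔ φ₀ x ∈ 𝒪[K₂]` of the [FrdII] Thm. 2.4 field-isomorphism files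
(`PadicKummerLocalFieldIsoIntegers`, `PadicKummerThm24iFieldIso`, `PadicKummerThm24iInstances`,
`PadicKummerThm24iiFieldIso`).  Proof-only; Mathlib + two tree lemmas; nothing here concerns [IUTchIII].
-/

noncomputable section

namespace Literature.NumberTheory.LocalFields

open ValuativeRel Valuation
open Literature.NumberTheory.GaloisRepresentations

variable {K : Type*} [Field K] [ValuativeRel K] [TopologicalSpace K] [IsNonarchimedeanLocalField K]

/-! ### Units have `n`-th roots for infinitely many `n`; non-units for finitely many -/

/-- A unit of `𝒪_K` (an element of valuation `1`) is an `ℓ`-th power in `K` for every prime `ℓ` exceeding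
the cardinality of the residue field (Hensel; the tree's `isUnit_exists_pow_eq_of_card_lt`).
[cite: NeukirchANT1999, Ch. II Prop. 5.7] -/
theorem exists_pow_eq_of_valuation_eq_one {z : K} (hz : valuation K z = 1) {ℓ : ℕ} (hℓ : ℓ.Prime)
    (hq : Nat.card 𝓀[K] < ℓ) : ∃ y : K, y ^ ℓ = z := by
  have hzO : z ∈ 𝒪[K] := (mem_integer_iff _ _).mpr hz.le
  have hu : IsUnit (⟨z, hzO⟩ : 𝒪[K]) :=
    (Valuation.integer.integers (valuation K)).isUnit_iff_valuation_eq_one.mpr hz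
  obtain ⟨y, -, hy⟩ := isUnit_exists_pow_eq_of_card_lt hℓ hq ⟨z, hzO⟩ hu
  exact ⟨(y : K), by rw [← Subring.coe_pow, hy]⟩

/-- **Units have `n`-th roots for infinitely many `n`**: for `v(z) = 1` the set
`{n : ℕ | ∃ y, yⁿ = z}` contains every prime `ℓ > #𝓀`, hence is infinite. [cite: NeukirchANT1999, Ch. II Prop. 5.7] -/
theorem infinite_setOf_exists_pow_eq_of_valuation_eq_one {z : K} (hz : valuation K z = 1) :
    {n : ℕ | ∃ y : K, y ^ n = z}.Infinite := by
  refine Set.Infinite.mono (s := {n : ℕ | n.Prime ∧ Nat.card 𝓀[K] < n}) ?_ ?_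
  · rintro n ⟨hn, hq⟩
    exact exists_pow_eq_of_valuation_eq_one hz hn hq
  · have h : {n : ℕ | n.Prime ∧ Nat.card 𝓀[K] < n} = {n : ℕ | n.Prime} \ Set.Iic (Nat.card 𝓀[K]) := by
      ext n
      simp only [Set.mem_setOf_eq, Set.mem_sdiff, Set.mem_Iic, not_le]
    rw [h]
    exact Nat.infinite_setOf_prime.sdiff (Set.finite_Iic _)

/-- **Non-units have `n`-th roots for finitely many `n` only**: if `z ≠ 0` and `v(z) ≠ 1` then
`{n : ℕ | ∃ y, yⁿ = z}` is finite (`v(z) = v(ϖ)^k` with `k ≠ 0`, and `yⁿ = z` gives `n · j = k` for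
`v(y) = v(ϖ)^j`, so `n ≤ |k|`). [cite: SerreLocalFields1979, Ch. II §3] -/
theorem finite_setOf_exists_pow_eq_of_valuation_ne_one {z : K} (hz0 : z ≠ 0) (hz : valuation K z ≠ 1) :
    {n : ℕ | ∃ y : K, y ^ n = z}.Finite := by
  obtain ⟨k, hk⟩ := exists_valuation_eq_unifValue_zpow K hz0
  have hk0 : k ≠ 0 := by
    rintro rfl
    exact hz (by rw [hk, zpow_zero])
  refine (Set.finite_Iic k.natAbs).subset ?_
  rintro n ⟨y, hy⟩
  simp only [Set.mem_Iic]
  have hy0 : y ≠ 0 := by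
    rintro rfl
    rcases Nat.eq_zero_or_pos n with hn | hn
    · subst hn; rw [pow_zero] at hy; exact hz (by rw [← hy, map_one])
    · exact hz0 (by rw [← hy, zero_pow hn.ne'])
  obtain ⟨j, hj⟩ := exists_valuation_eq_unifValue_zpow K hy0
  have hinj := (zpow_right_strictAnti₀ (unifValue_pos K) (unifValue_lt_one K)).injective
  have hnjk : (n : ℤ) * j = k := by
    apply hinj
    dsimp only
    rw [← hk, ← hy, map_pow, hj, ← zpow_natCast, ← zpow_mul, mul_comm]
  have hdvd : (n : ℤ) ∣ k := ⟨j, hnjk.symm⟩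
  have := Int.natAbs_dvd_natAbs.mpr hdvd
  rw [Int.natAbs_natCast] at this
  exact Nat.le_of_dvd (Int.natAbs_pos.mpr hk0) this

/-- **`v(z) = 1` is a property of the field structure**: `v(z) = 1 ↔ z ≠ 0 ∧ {n | ∃ y, yⁿ = z}` is infinite.
[cite: SerreLocalFields1979, Ch. II §3] -/
theorem valuation_eq_one_iff_infinite (z : K) :
    valuation K z = 1 ↔ z ≠ 0 ∧ {n : ℕ | ∃ y : K, y ^ n = z}.Infinite := by
  constructor
  · intro hz
    refine ⟨fun h => ?_, infinite_setOf_exists_pow_eq_of_valuation_eq_one hz⟩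
    rw [h, map_zero] at hz
    exact zero_ne_one hz
  · rintro ⟨hz0, hinf⟩
    by_contra hz
    exact hinf (finite_setOf_exists_pow_eq_of_valuation_ne_one hz0 hz)

omit [TopologicalSpace K] [IsNonarchimedeanLocalField K] in
/-- **`𝒪_K` from the units**: `x ∈ 𝒪_K ↔ v(x) = 1 ∨ v(1 + x) = 1` (if `v(x) < 1` then `v(1 + x) = 1`; if
`v(x) > 1` then `v(1 + x) = v(x)`). [cite: SerreLocalFields1979, Ch. II §3] -/
theorem mem_integer_iff_valuation_eq_one_or (x : K) :
    x ∈ 𝒪[K] ↔ valuation K x = 1 ∨ valuation K (1 + x) = 1 := by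
  rw [mem_integer_iff]
  constructor
  · intro hx
    rcases hx.lt_or_eq with hlt | heq
    · right
      rw [map_add_eq_of_lt_left (valuation K) (by rwa [map_one]), map_one]
    · exact Or.inl heq
  · rintro (h | h)
    · exact h.le
    · have hx : x = (1 + x) - 1 := by ring
      rw [hx]
      exact map_sub_le (valuation K) h.le (by rw [map_one])

/-! ### Ring isomorphisms of local fields are valuative -/

variable {K₁ : Type*} [Field K₁] [ValuativeRel K₁] [TopologicalSpace K₁] [IsNonarchimedeanLocalField K₁]
  {K₂ : Type*} [Field K₂] [ValuativeRel K₂] [TopologicalSpace K₂] [IsNonarchimedeanLocalField K₂]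

omit [ValuativeRel K₁] [TopologicalSpace K₁] [IsNonarchimedeanLocalField K₁] [ValuativeRel K₂]
  [TopologicalSpace K₂] [IsNonarchimedeanLocalField K₂] in
/-- The set `{n | ∃ y, yⁿ = z}` is transported by a ring isomorphism. [cite: SerreLocalFields1979, Ch. II §3] -/
private theorem RingEquiv.setOf_exists_pow_eq_map (φ : K₁ ≃+* K₂) (z : K₁) :
    {n : ℕ | ∃ y : K₂, y ^ n = φ z} = {n : ℕ | ∃ y : K₁, y ^ n = z} := by
  ext n
  simp only [Set.mem_setOf_eq]
  constructor
  · rintro ⟨y, hy⟩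
    exact ⟨φ.symm y, φ.injective (by rw [map_pow, RingEquiv.apply_symm_apply, hy])⟩
  · rintro ⟨y, hy⟩
    exact ⟨φ y, by rw [← map_pow, hy]⟩

/-- **A ring isomorphism of non-archimedean local fields preserves the units of the valuation rings**:
`v₁(z) = 1 ↔ v₂(φ z) = 1`. [cite: SerreLocalFields1979, Ch. II §3] -/
theorem RingEquiv.valuation_eq_one_iff_localField (φ : K₁ ≃+* K₂) (z : K₁) :
    valuation K₁ z = 1 ↔ valuation K₂ (φ z) = 1 := by
  rw [valuation_eq_one_iff_infinite, valuation_eq_one_iff_infinite, RingEquiv.setOf_exists_pow_eq_map,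
    φ.map_ne_zero_iff]

/-- **A ring isomorphism of non-archimedean local fields maps `𝒪_{K₁}` onto `𝒪_{K₂}`**:
`x ∈ 𝒪[K₁] ↔ φ x ∈ 𝒪[K₂]` — every field isomorphism of local fields is "valuative" (equivalently,
continuous).  This is the binder `hφ₀` of the cell's [FrdII] Thm. 2.4 field-isomorphism files, discharged.
[cite: SerreLocalFields1979, Ch. II §3] -/
theorem RingEquiv.mem_integer_iff_localField (φ : K₁ ≃+* K₂) (x : K₁) : x ∈ 𝒪[K₁] ↔ φ x ∈ 𝒪[K₂] := by
  rw [mem_integer_iff_valuation_eq_one_or, mem_integer_iff_valuation_eq_one_or,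
    RingEquiv.valuation_eq_one_iff_localField φ, RingEquiv.valuation_eq_one_iff_localField φ, map_add, map_one]

/-- The binder in the exact shape the [FrdII] Thm. 2.4 files take it (`∀ x, x ∈ 𝒪[K₁] ↔ φ₀ x ∈ 𝒪[K₂]`).
[cite: SerreLocalFields1979, Ch. II §3] -/
theorem RingEquiv.forall_mem_integer_iff_localField (φ : K₁ ≃+* K₂) :
    ∀ x : K₁, x ∈ 𝒪[K₁] ↔ φ x ∈ 𝒪[K₂] :=
  RingEquiv.mem_integer_iff_localField φ

/-- **… and preserves the valuation ORDER**: `v₁ x ≤ v₁ y ↔ v₂ (φ x) ≤ v₂ (φ y)` (divisibility in the valuation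
rings). [cite: SerreLocalFields1979, Ch. II §3] -/
theorem RingEquiv.valuation_le_valuation_iff_localField (φ : K₁ ≃+* K₂) (x y : K₁) :
    valuation K₁ x ≤ valuation K₁ y ↔ valuation K₂ (φ x) ≤ valuation K₂ (φ y) := by
  by_cases hy : y = 0
  · subst hy
    simp only [map_zero, le_zero_iff, map_eq_zero, φ.map_eq_zero_iff]
  have hy' : φ y ≠ 0 := φ.map_ne_zero_iff.mpr hy
  have h1 : valuation K₁ x ≤ valuation K₁ y ↔ x / y ∈ 𝒪[K₁] := by
    rw [mem_integer_iff, map_div₀, div_le_one₀ ((Valuation.pos_iff _).mpr hy)]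
  have h2 : valuation K₂ (φ x) ≤ valuation K₂ (φ y) ↔ φ x / φ y ∈ 𝒪[K₂] := by
    rw [mem_integer_iff, map_div₀, div_le_one₀ ((Valuation.pos_iff _).mpr hy')]
  rw [h1, h2, ← map_div₀, RingEquiv.mem_integer_iff_localField φ]

end Literature.NumberTheory.LocalFields

end
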